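import Summits.QuantumFields.QCD.Theses.QuarksNoInfraredClause
import Summits.QuantumFields.QCD.Theses.CounterexampleMustBeHot
import Summits.QuantumFields.QCD.Theorems.GapBuysCauchyRateConvergentOSClosureStubClosureOfLatticeInputs
import Summits.QuantumFields.QCD.Theorems.QuarksNoInfraredClauseThinQCDStubDiagonalExtraction
import Summits.QuantumFields.QCD.Theorems.QuarksNoInfraredClauseThinQCDClosureNoGap
import Literature.MathematicalPhysics.QuantumFieldTheory.QCDGoldstoneBound
import Literature.MathematicalPhysics.QuantumFieldTheory.QCDAsymptoticScalingCouplingDivergence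
import Literature.MathematicalPhysics.QuantumFieldTheory.QCDFlavourSymmetry
import HarnessLib

/-!
# Crux `ThinQCD` (item stmt-QuantumFields-17278), skeleton r5: reindexed calibrated families and transport lemmas

Support file of line `registered` (route `QuarksNoInfraredClause`, sub-problem QCD; `--supports stmt-QuantumFields-17278`):
the bookkeeping half of the r5 composition (`Cruxes/ThinQCD/Lines/birth.lean` §3), used by `…ThinQCDOfPiecesR5.lean` for the
two kernel-checked implications below.  A REINDEXED calibrated family `𝒞₂` over `reg.restrict ψ hψ` is any family whose
renormalisations are `z_s(m, ψ k)`, `shift_s(m, ψ k)` (`hz`, `hshift`; the Literature definition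
`CalibratedSpeciesFamily.reindex` is proposed separately, p167857); its lattice `n`-point functions, canonical distributions,
thermal distributions and two-point functions ARE the reindexed ones (`scheme_eq_of_reindexData` + `rfl`), so every
`∀ᶠ`-clause of the calibrated package rides along `ψ`, and scaling / branch / full or NEUTRAL lattice gap are transported across
the ties `a, β, m_crit, Z_m ∘ φ` with enlarged volumes (`*_transport`).  No `sorry`, no definition.  The implications served:

* `thinQCD_of_pieces_r5` — THE ITEM-LEVEL UPPER BRACKET of the crux after reshape r5 (`Cruxes/ThinQCD/RESHAPE-r5.md`):
  (S1′ the chiral lattice half: ∃ reg with mass scaling, chiral at zero, two-loop scaling, ∀ m>0 branch + FULL uniform lattice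
  gap) → (U1 the calibrated lattice package along a chirality-keeping reindexing: Goldstone bound, ⁰𝒮-tightness locally
  uniform in the masses, mass-Lipschitz, and per tuple biting calibrations / κ₃ / (T∧COMP) / CL / CS) →
  `CounterexampleMustBeHot.RotationRestoration` (8840) → `ThinQCD`.  The diagonal extraction DE is the LANDED
  `Summit.QuantumFields.QCD.Theorems.ThinQCD.stub_diagonalExtraction` (p167000), the OS closure the landed
  `ConvergentOSClosure.stub_closureOfLatticeInputs`; the witness is `reg₁.restrict ψ` with the reindexed calibrated family
  (built as a term; its lattice `n`-point functions are the reindexed ones).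
* `thinQCD_of_thin` — THE ROUTE'S THESIS AT THE LEVEL OF THIS CRUX: the same with the NEUTRAL lattice gap everywhere (r4's thin
  anchor; the package and rotation restoration asked under the neutral gap), through the landed GAP-FREE closure
  `closureOfLatticeInputs_noGap` (R″, p167771): the thin crux needs NO half-spectrum lemma (`TorusHalfSpectrum`, found
  misstated as filed by three leads of stmt-9508) once the neighbours 18044 / 8840 thin their idle resp. neutral-sufficient gap
  hypothesis.

References: Osterwalder–Schrader II (1975) §2, §4; Glimm–Jaffe (1987) §6.1; Montvay–Münster (1994) §1.7, §5.1.
-/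

noncomputable section

namespace Summit.QuantumFields.QCD.Theorems.ThinQCD.R5

open scoped BigOperators Topology SchwartzMap
open MeasureTheory Filter
open Literature.MathematicalPhysics.QuantumFieldTheory Literature.MathematicalPhysics.QuantumLattice
  Literature.MathematicalPhysics.AQFT
open Summit.QuantumFields.QCD.Cruxes.StableActionBridge.Sketch (qcdLatticeDist qcdLatticeDistSymAP
  qcdLatticeSchwinger_eq_qcdLatticeDist)
open Summit.QuantumFields.QCD.Theorems.ConvergentOSClosure (stub_closureOfLatticeInputs)
open Summit.QuantumFields.QCD.Cruxes.ThinQCD.Registered (closureOfLatticeInputs_noGap)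

variable {Nf : ℕ}

/-! ## Small tools -/

/-- `N_f ∈ {2, 3}` are physical flavour numbers (`≤ 16`, asymptotic freedom). [folklore] -/
theorem le_sixteen_of_two_or_three {Nf : ℕ} (hNf : Nf = 2 ∨ Nf = 3) : Nf ≤ 16 := by
  rcases hNf with rfl | rfl <;> norm_num

/-! ## A reindexed calibrated family: its lattice functions are the reindexed ones -/

section Reindex

variable {reg : QCDRegularisation Nf} (𝒞 : CalibratedSpeciesFamily reg) (ψ : ℕ → ℕ) (hψ : Tendsto ψ atTop atTop)
  (𝒞₂ : CalibratedSpeciesFamily (reg.restrict ψ hψ))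
  (hz : ∀ m s k, 𝒞₂.z m s k = 𝒞.z m s (ψ k)) (hshift : ∀ m s k, 𝒞₂.shift m s k = 𝒞.shift m s (ψ k))

include hz hshift in
/-- The scheme of a reindexed family at `m` is the reindexed scheme with the reindexed species data. [folklore] -/
theorem scheme_eq_of_reindexData (m : Fin Nf → ℝ) :
    𝒞₂.scheme m = (reg.restrict ψ hψ).scheme m (fun s k => 𝒞.z m s (ψ k)) (fun s k => 𝒞.shift m s (ψ k)) := by
  have h1 : 𝒞₂.z m = fun s k => 𝒞.z m s (ψ k) := funext fun s => funext fun k => hz m s k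
  have h2 : 𝒞₂.shift m = fun s k => 𝒞.shift m s (ψ k) := funext fun s => funext fun k => hshift m s k
  rw [CalibratedSpeciesFamily.scheme_eq, h1, h2]

include hz hshift

/-- The lattice `n`-point functions of the reindexed family are the reindexed ones (definitional). [folklore] -/
theorem qcdLatticeSchwinger_reindex (m : Fin Nf → ℝ) (k n : ℕ) (σ : Fin n → QCDField Nf)
    (f : Fin n → 𝓢(EuclideanSpace ℝ (Fin 4), ℝ)) :
    qcdLatticeSchwinger (𝒞₂.scheme m) k n σ f = qcdLatticeSchwinger (𝒞.scheme m) (ψ k) n σ f := by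
  rw [scheme_eq_of_reindexData 𝒞 ψ hψ 𝒞₂ hz hshift]; rfl

/-- The canonical lattice distributions of the reindexed family are the reindexed ones (definitional). [folklore] -/
theorem qcdLatticeDist_reindex (m : Fin Nf → ℝ) (k n : ℕ) (σ : Fin n → QCDField Nf) :
    qcdLatticeDist (𝒞₂.scheme m) k n σ = qcdLatticeDist (𝒞.scheme m) (ψ k) n σ := by
  rw [scheme_eq_of_reindexData 𝒞 ψ hψ 𝒞₂ hz hshift]; rfl

/-- The Θ-symmetrised thermal distributions of the reindexed family are the reindexed ones (definitional). [folklore] -/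
theorem qcdLatticeDistSymAP_reindex (m : Fin Nf → ℝ) (k n : ℕ) (σ : Fin n → QCDField Nf) :
    qcdLatticeDistSymAP (𝒞₂.scheme m) k n σ = qcdLatticeDistSymAP (𝒞.scheme m) (ψ k) n σ := by
  rw [scheme_eq_of_reindexData 𝒞 ψ hψ 𝒞₂ hz hshift]; rfl

/-- The two-point functions of the reindexed family are the reindexed ones (definitional). [folklore] -/
theorem twoPoint_reindex (m : Fin Nf → ℝ) (k : ℕ) :
    (𝒞₂.scheme m).twoPoint k = (𝒞.scheme m).twoPoint (ψ k) := by
  rw [scheme_eq_of_reindexData 𝒞 ψ hψ 𝒞₂ hz hshift]; rfl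

/-- Species Cauchy–Schwarz clustering rides along the reindexing (it is a `∀ᶠ`-clause). [folklore] -/
theorem hasSpeciesCSClustering_reindex {m : Fin Nf → ℝ} {Δ : ℝ} (h : (𝒞.scheme m).HasSpeciesCSClustering Δ) :
    (𝒞₂.scheme m).HasSpeciesCSClustering Δ := by
  intro n n' hn hn' σ σ' N N' c c' p q hp hq t ht ε hε
  have h' := hψ.eventually (h n n' hn hn' σ σ' N N' c c' p q hp hq t ht ε hε)
  refine h'.mono fun k hk => ?_
  simpa only [qcdLatticeSchwinger_reindex 𝒞 ψ hψ 𝒞₂ hz hshift] using hk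

/-- The glue calibration rides along the reindexing. [folklore] -/
theorem twoPoint_glue_reindex (hf₀ : 𝒞₂.f₀ = 𝒞.f₀) {m : Fin Nf → ℝ}
    (h : ∀ᶠ k in Filter.atTop, (𝒞.scheme m).twoPoint k QCDField.glue QCDField.glue (thetaTest 4 𝒞.f₀) 𝒞.f₀ = 1) :
    ∀ᶠ k in Filter.atTop, (𝒞₂.scheme m).twoPoint k QCDField.glue QCDField.glue
      (thetaTest 4 𝒞₂.f₀) 𝒞₂.f₀ = 1 :=
  (hψ.eventually h).mono fun k hk => by rw [twoPoint_reindex 𝒞 ψ hψ 𝒞₂ hz hshift, hf₀]; exact hk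

/-- The flavour-changing calibrations ride along the reindexing. [folklore] -/
theorem twoPoint_pseudoRe_reindex (hf₀ : 𝒞₂.f₀ = 𝒞.f₀) {m : Fin Nf → ℝ}
    (h : ∀ f g : Fin Nf, f ≠ g → ∀ᶠ k in Filter.atTop,
      (𝒞.scheme m).twoPoint k (QCDField.pseudoRe f g) (QCDField.pseudoRe f g) (thetaTest 4 𝒞.f₀) 𝒞.f₀ = 1) :
    ∀ f g : Fin Nf, f ≠ g → ∀ᶠ k in Filter.atTop,
      (𝒞₂.scheme m).twoPoint k (QCDField.pseudoRe f g) (QCDField.pseudoRe f g)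
        (thetaTest 4 𝒞₂.f₀) 𝒞₂.f₀ = 1 :=
  fun f g hne => (hψ.eventually (h f g hne)).mono fun k hk => by rw [twoPoint_reindex 𝒞 ψ hψ 𝒞₂ hz hshift, hf₀]; exact hk

/-- The glue `κ₃`-witness rides along the reindexing. [folklore] -/
theorem kappa3_reindex {m : Fin Nf → ℝ}
    (h : ∃ f g h : SchwartzMap (EuclideanSpace ℝ (Fin 4)) ℝ,
      tsupport (f : EuclideanSpace ℝ (Fin 4) → ℝ) ⊆ {x | x 0 < 0} ∧
      tsupport (g : EuclideanSpace ℝ (Fin 4) → ℝ) ⊆ {x | 0 < x 0 ∧ x 0 < 1} ∧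
      tsupport (h : EuclideanSpace ℝ (Fin 4) → ℝ) ⊆ {x | 1 < x 0} ∧
      ∃ ε > (0 : ℝ), ∀ᶠ k in Filter.atTop, ε ≤ ‖qcdLatticeSchwinger (𝒞.scheme m) k 3
        ![QCDField.glue, QCDField.glue, QCDField.glue] ![f, g, h] -
        qcdLatticeSchwinger (𝒞.scheme m) k 1 ![QCDField.glue] ![f] *
          qcdLatticeSchwinger (𝒞.scheme m) k 2 ![QCDField.glue, QCDField.glue] ![g, h] -
        qcdLatticeSchwinger (𝒞.scheme m) k 1 ![QCDField.glue] ![g] *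
          qcdLatticeSchwinger (𝒞.scheme m) k 2 ![QCDField.glue, QCDField.glue] ![f, h] -
        qcdLatticeSchwinger (𝒞.scheme m) k 1 ![QCDField.glue] ![h] *
          qcdLatticeSchwinger (𝒞.scheme m) k 2 ![QCDField.glue, QCDField.glue] ![f, g] +
        2 * (qcdLatticeSchwinger (𝒞.scheme m) k 1 ![QCDField.glue] ![f] *
          qcdLatticeSchwinger (𝒞.scheme m) k 1 ![QCDField.glue] ![g] *
          qcdLatticeSchwinger (𝒞.scheme m) k 1 ![QCDField.glue] ![h])‖) :
    ∃ f g h : SchwartzMap (EuclideanSpace ℝ (Fin 4)) ℝ,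
      tsupport (f : EuclideanSpace ℝ (Fin 4) → ℝ) ⊆ {x | x 0 < 0} ∧
      tsupport (g : EuclideanSpace ℝ (Fin 4) → ℝ) ⊆ {x | 0 < x 0 ∧ x 0 < 1} ∧
      tsupport (h : EuclideanSpace ℝ (Fin 4) → ℝ) ⊆ {x | 1 < x 0} ∧
      ∃ ε > (0 : ℝ), ∀ᶠ k in Filter.atTop, ε ≤ ‖qcdLatticeSchwinger (𝒞₂.scheme m) k 3
        ![QCDField.glue, QCDField.glue, QCDField.glue] ![f, g, h] -
        qcdLatticeSchwinger (𝒞₂.scheme m) k 1 ![QCDField.glue] ![f] *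
          qcdLatticeSchwinger (𝒞₂.scheme m) k 2 ![QCDField.glue, QCDField.glue] ![g, h] -
        qcdLatticeSchwinger (𝒞₂.scheme m) k 1 ![QCDField.glue] ![g] *
          qcdLatticeSchwinger (𝒞₂.scheme m) k 2 ![QCDField.glue, QCDField.glue] ![f, h] -
        qcdLatticeSchwinger (𝒞₂.scheme m) k 1 ![QCDField.glue] ![h] *
          qcdLatticeSchwinger (𝒞₂.scheme m) k 2 ![QCDField.glue, QCDField.glue] ![f, g] +
        2 * (qcdLatticeSchwinger (𝒞₂.scheme m) k 1 ![QCDField.glue] ![f] *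
          qcdLatticeSchwinger (𝒞₂.scheme m) k 1 ![QCDField.glue] ![g] *
          qcdLatticeSchwinger (𝒞₂.scheme m) k 1 ![QCDField.glue] ![h])‖ := by
  obtain ⟨f, g, h', hf, hg, hh, ε, hε, hev⟩ := h
  refine ⟨f, g, h', hf, hg, hh, ε, hε, (hψ.eventually hev).mono fun k hk => ?_⟩
  simpa only [qcdLatticeSchwinger_reindex 𝒞 ψ hψ 𝒞₂ hz hshift] using hk

/-- The k-uniform E0′ bound (T) rides along the reindexing. [folklore] -/
theorem bound_reindex {m : Fin Nf → ℝ} {s : ℕ} {α β : ℝ}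
    (h : ∀ (n : ℕ) (σ : Fin n → QCDField Nf), ∀ᶠ k in Filter.atTop,
      ∀ F : SchwartzMap (Fin n → EuclideanSpace ℝ (Fin 4)) ℂ, IsOffDiagonal F →
        ‖qcdLatticeDist (𝒞.scheme m) k n σ F‖ ≤ α * (n.factorial : ℝ) ^ β * schwartzNorm (n * s) F) :
    ∀ (n : ℕ) (σ : Fin n → QCDField Nf), ∀ᶠ k in Filter.atTop,
      ∀ F : SchwartzMap (Fin n → EuclideanSpace ℝ (Fin 4)) ℂ, IsOffDiagonal F →
        ‖qcdLatticeDist (𝒞₂.scheme m) k n σ F‖ ≤ α * (n.factorial : ℝ) ^ β * schwartzNorm (n * s) F :=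
  fun n σ => (hψ.eventually (h n σ)).mono fun k hk => by rw [qcdLatticeDist_reindex 𝒞 ψ hψ 𝒞₂ hz hshift]; exact hk

/-- The thermal comparison (COMP) rides along the reindexing. [folklore] -/
theorem comp_reindex {m : Fin Nf → ℝ} {s : ℕ}
    (h : ∀ ε : ℝ, 0 < ε → ∀ (n : ℕ) (σ : Fin n → QCDField Nf), ∀ᶠ k in Filter.atTop,
      ∀ F : SchwartzMap (Fin n → EuclideanSpace ℝ (Fin 4)) ℂ, IsOffDiagonal F →
        ‖qcdLatticeDistSymAP (𝒞.scheme m) k n σ F - qcdLatticeDist (𝒞.scheme m) k n σ F‖ ≤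
          ε * schwartzNorm (n * s) F) :
    ∀ ε : ℝ, 0 < ε → ∀ (n : ℕ) (σ : Fin n → QCDField Nf), ∀ᶠ k in Filter.atTop,
      ∀ F : SchwartzMap (Fin n → EuclideanSpace ℝ (Fin 4)) ℂ, IsOffDiagonal F →
        ‖qcdLatticeDistSymAP (𝒞₂.scheme m) k n σ F - qcdLatticeDist (𝒞₂.scheme m) k n σ F‖ ≤
          ε * schwartzNorm (n * s) F :=
  fun ε hε n σ => (hψ.eventually (h ε hε n σ)).mono fun k hk => by
    rw [qcdLatticeDist_reindex 𝒞 ψ hψ 𝒞₂ hz hshift, qcdLatticeDistSymAP_reindex 𝒞 ψ hψ 𝒞₂ hz hshift]; exact hk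

/-- Spatial clustering (CL) rides along the reindexing. [folklore] -/
theorem cl_reindex {m : Fin Nf → ℝ}
    (h : ∀ (n n' : ℕ) (σ : Fin n → QCDField Nf) (σ' : Fin n' → QCDField Nf)
      (F : SchwartzMap (Fin n → EuclideanSpace ℝ (Fin 4)) ℂ) (G : SchwartzMap (Fin n' → EuclideanSpace ℝ (Fin 4)) ℂ),
      IsTimeOrdered F → IsTimeOrdered G → ∀ a : EuclideanSpace ℝ (Fin 4), a 0 = 0 → a ≠ 0 →
      ∀ ε : ℝ, 0 < ε → ∃ t₀ : ℝ, ∀ t : ℝ, t₀ ≤ t →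
        ∀ H : SchwartzMap (Fin (n + n') → EuclideanSpace ℝ (Fin 4)) ℂ,
          IsAppendTensorOf H (osAdjoint F) (translateMulti (t • a) G) →
          ∀ᶠ k in Filter.atTop, ‖qcdLatticeDist (𝒞.scheme m) k (n + n') (Fin.append (σ ∘ Fin.rev) σ') H -
            qcdLatticeDist (𝒞.scheme m) k n (σ ∘ Fin.rev) (osAdjoint F) *
              qcdLatticeDist (𝒞.scheme m) k n' σ' G‖ ≤ ε) :
    ∀ (n n' : ℕ) (σ : Fin n → QCDField Nf) (σ' : Fin n' → QCDField Nf)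
      (F : SchwartzMap (Fin n → EuclideanSpace ℝ (Fin 4)) ℂ) (G : SchwartzMap (Fin n' → EuclideanSpace ℝ (Fin 4)) ℂ),
      IsTimeOrdered F → IsTimeOrdered G → ∀ a : EuclideanSpace ℝ (Fin 4), a 0 = 0 → a ≠ 0 →
      ∀ ε : ℝ, 0 < ε → ∃ t₀ : ℝ, ∀ t : ℝ, t₀ ≤ t →
        ∀ H : SchwartzMap (Fin (n + n') → EuclideanSpace ℝ (Fin 4)) ℂ,
          IsAppendTensorOf H (osAdjoint F) (translateMulti (t • a) G) →
          ∀ᶠ k in Filter.atTop, ‖qcdLatticeDist (𝒞₂.scheme m) k (n + n') (Fin.append (σ ∘ Fin.rev) σ') H -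
            qcdLatticeDist (𝒞₂.scheme m) k n (σ ∘ Fin.rev) (osAdjoint F) *
              qcdLatticeDist (𝒞₂.scheme m) k n' σ' G‖ ≤ ε := by
  intro n n' σ σ' F G hF hG a ha0 ha ε hε
  obtain ⟨t₀, ht₀⟩ := h n n' σ σ' F G hF hG a ha0 ha ε hε
  refine ⟨t₀, fun t ht H hH => (hψ.eventually (ht₀ t ht H hH)).mono fun k hk => ?_⟩
  rw [qcdLatticeDist_reindex 𝒞 ψ hψ 𝒞₂ hz hshift, qcdLatticeDist_reindex 𝒞 ψ hψ 𝒞₂ hz hshift,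
    qcdLatticeDist_reindex 𝒞 ψ hψ 𝒞₂ hz hshift]; exact hk

/-- **Convergence along `ψ` IS convergence of the reindexed family** on off-diagonal real tensors (read through
`qcdLatticeSchwinger_eq_qcdLatticeDist`). [folklore] -/
theorem converges_reindex {m : Fin Nf → ℝ}
    (h : ∀ (n : ℕ) (σ : Fin n → QCDField Nf) (F : SchwartzMap (Fin n → EuclideanSpace ℝ (Fin 4)) ℂ), IsOffDiagonal F →
      ∃ c : ℂ, Filter.Tendsto (fun k : ℕ => qcdLatticeDist (𝒞.scheme m) (ψ k) n σ F) Filter.atTop (nhds c)) :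
    ∀ n : ℕ, n ≠ 0 → ∀ (σ : Fin n → QCDField Nf) (f : Fin n → SchwartzMap (EuclideanSpace ℝ (Fin 4)) ℝ)
      (F : SchwartzMap (Fin n → EuclideanSpace ℝ (Fin 4)) ℂ), IsTensorOf F (fun i => ofRealTest (f i)) →
      IsOffDiagonal F → ∃ c : ℂ,
        Filter.Tendsto (fun k : ℕ => qcdLatticeSchwinger (𝒞₂.scheme m) k n σ f) Filter.atTop (nhds c) := by
  intro n hn σ f F hF hoff
  obtain ⟨c, hc⟩ := h n σ F hoff
  refine ⟨c, hc.congr fun k => ?_⟩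
  rw [qcdLatticeSchwinger_reindex 𝒞 ψ hψ 𝒞₂ hz hshift,
    ← qcdLatticeSchwinger_eq_qcdLatticeDist (𝒞.scheme m) (ψ k) n hn σ f F hF]

end Reindex

/-! ## Transport of the anchor's clauses across the ties and the reindexing -/

section Transport

variable {reg reg₁ : QCDRegularisation Nf} {φ ψ : ℕ → ℕ}

/-- Leading-log mass scaling reads only `a` and `Z_m`: it passes across the ties and the reindexing. [folklore] -/
theorem hasMassScaling_transport (hφ : StrictMono φ) (hψ : Tendsto ψ atTop atTop) (ha : reg₁.a = reg.a ∘ φ)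
    (hZm : reg₁.Zm = reg.Zm ∘ φ) (h : reg.HasMassScaling) : (reg₁.restrict ψ hψ).HasMassScaling := by
  obtain ⟨c, hc, ht⟩ := h
  refine ⟨c, hc, ?_⟩
  have hfun : (fun k => (reg₁.restrict ψ hψ).Zm k / Real.log (1 / (reg₁.restrict ψ hψ).a k ^ 2) ^ massExponent Nf) =
      (fun k => reg.Zm k / Real.log (1 / reg.a k ^ 2) ^ massExponent Nf) ∘ (φ ∘ ψ) := by
    funext k; simp [ha, hZm]
  rw [hfun]
  exact ht.comp (hφ.tendsto_atTop.comp hψ)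


/-- Two-loop asymptotic scaling reads only `β` and `a`. [folklore] -/
theorem hasAsymptoticScaling_transport (hφ : StrictMono φ) {hψ : Tendsto ψ atTop atTop}
    (𝒞₂ : CalibratedSpeciesFamily (reg₁.restrict ψ hψ)) (ha : reg₁.a = reg.a ∘ φ)
    (hβ : reg₁.β = reg.β ∘ φ) (h : (reg.scheme 0 0 0).HasAsymptoticScaling) (m : Fin Nf → ℝ) :
    (𝒞₂.scheme m).HasAsymptoticScaling := by
  obtain ⟨Λ, hΛ, ht⟩ := h
  refine ⟨Λ, hΛ, ?_⟩
  have hfun : (fun k => (𝒞₂.scheme m).β k - afBeta Nf Λ ((𝒞₂.scheme m).a k)) =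
      (fun k => (reg.scheme 0 0 0).β k - afBeta Nf Λ ((reg.scheme 0 0 0).a k)) ∘ (φ ∘ ψ) := by
    funext k
    simp [QCDRegularisation.scheme, ha, hβ]
  rw [hfun]
  exact ht.comp (hφ.tendsto_atTop.comp hψ)

/-- The physical branch reads `m_crit`, `a`, `Z_m`. [folklore] -/
theorem branch_transport (hφ : StrictMono φ) {hψ : Tendsto ψ atTop atTop}
    (𝒞₂ : CalibratedSpeciesFamily (reg₁.restrict ψ hψ)) (ha : reg₁.a = reg.a ∘ φ)
    (hmc : reg₁.mcrit = reg.mcrit ∘ φ) (hZm : reg₁.Zm = reg.Zm ∘ φ) {m : Fin Nf → ℝ}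
    (h : ∀ f, ∀ᶠ k in Filter.atTop, -1 < (reg.scheme m 0 0).mq f k) :
    ∀ fl : Fin Nf, ∀ᶠ k in Filter.atTop, -1 < (𝒞₂.scheme m).mq fl k := by
  intro fl
  refine ((hφ.tendsto_atTop.comp hψ).eventually (h fl)).mono fun k hk => ?_
  simpa [ha, hmc, hZm] using hk

/-- The uniform lattice gap reads `a, β, m_crit, Z_m` and SURVIVES THE VOLUME ENLARGEMENT (all tori `S ≥ L_k` are
quantified). [folklore] -/
theorem gap_transport (hφ : StrictMono φ) {hψ : Tendsto ψ atTop atTop}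
    (𝒞₂ : CalibratedSpeciesFamily (reg₁.restrict ψ hψ)) (ha : reg₁.a = reg.a ∘ φ)
    (hβ : reg₁.β = reg.β ∘ φ) (hmc : reg₁.mcrit = reg.mcrit ∘ φ) (hZm : reg₁.Zm = reg.Zm ∘ φ)
    (hL : ∀ k, reg.L (φ k) ≤ reg₁.L k) {m : Fin Nf → ℝ} {Δ : ℝ} (h : (reg.scheme m 0 0).HasLatticeMassGap Δ) :
    (𝒞₂.scheme m).HasLatticeMassGap Δ := by
  intro R R' A B
  obtain ⟨C, hC⟩ := h R R' A B
  refine ⟨C, ((hφ.tendsto_atTop.comp hψ).eventually hC).mono fun k hk S hS n hn => ?_⟩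
  have hS' : (reg.scheme m 0 0).L (φ (ψ k)) ≤ S :=
    (hL (ψ k)).trans (by simpa [QCDRegularisation.scheme] using hS)
  simpa [QCDRegularisation.scheme, ha, hβ, hmc, hZm] using hk S hS' n hn

end Transport

section ThinTransport

variable {reg reg₁ : QCDRegularisation Nf} {φ ψ : ℕ → ℕ}

/-- The uniform NEUTRAL lattice gap reads `a, β, m_crit, Z_m` and survives the volume enlargement. [folklore] -/
theorem neutralGap_transport (hφ : StrictMono φ) {hψ : Tendsto ψ atTop atTop}
    (𝒞₂ : CalibratedSpeciesFamily (reg₁.restrict ψ hψ)) (ha : reg₁.a = reg.a ∘ φ)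
    (hβ : reg₁.β = reg.β ∘ φ) (hmc : reg₁.mcrit = reg.mcrit ∘ φ) (hZm : reg₁.Zm = reg.Zm ∘ φ)
    (hL : ∀ k, reg.L (φ k) ≤ reg₁.L k) {m : Fin Nf → ℝ} {Δ : ℝ} (h : (reg.scheme m 0 0).HasNeutralLatticeMassGap Δ) :
    (𝒞₂.scheme m).HasNeutralLatticeMassGap Δ := by
  intro R R' A B hAn hBn
  obtain ⟨C, hC⟩ := h R R' A B hAn hBn
  refine ⟨C, ((hφ.tendsto_atTop.comp hψ).eventually hC).mono fun k hk S hS n hn => ?_⟩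
  have hS' : (reg.scheme m 0 0).L (φ (ψ k)) ≤ S :=
    (hL (ψ k)).trans (by simpa [QCDRegularisation.scheme] using hS)
  simpa [QCDRegularisation.scheme, ha, hβ, hmc, hZm] using hk S hS' n hn

end ThinTransport

/-- **Leading-log mass scaling passes across the ties and the reindexing** (∀-form of `hasMassScaling_transport`, the
registered sub-goal of this bookkeeping file). [folklore] -/
theorem hasMassScaling_transport_all :
    ∀ {Nf : ℕ} {reg reg₁ : QCDRegularisation Nf} {φ ψ : ℕ → ℕ}, StrictMono φ → ∀ hψ : Filter.Tendsto ψ Filter.atTop Filter.atTop,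
      reg₁.a = reg.a ∘ φ → reg₁.Zm = reg.Zm ∘ φ → reg.HasMassScaling → (reg₁.restrict ψ hψ).HasMassScaling :=
  fun hφ hψ ha hZm h => hasMassScaling_transport hφ hψ ha hZm h

end Summit.QuantumFields.QCD.Theorems.ThinQCD.R5

end
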